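import Summits.NavierStokesRegularity.NavierStokesRegularity.Theses.SelfMixingDichotomy
import Literature.Analysis.FluidPDE.PartialRegularity
import Literature.Analysis.FluidPDE.LocalTypeICongr
import Literature.Analysis.FluidPDE.LeraySuitableWeakSolutions
import Literature.Analysis.FluidPDE.NSWeakStrongUniquenessHolds
import Literature.Analysis.FluidPDE.TaoLocalisationHolds
import Literature.Analysis.FluidPDE.TaoLocalisationProofs
import Literature.Analysis.FluidPDE.Seregin2020ScaledEnergyBounds
import Literature.Analysis.FluidPDE.KatoMaximalTimeSingular
import Literature.Analysis.FluidPDE.ClassicalTopPointRegularity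
import Literature.Analysis.FluidPDE.LerayHopfProofs

/-!
# Route SelfMixingDichotomy — crux `CoherentScaleExclusion` (S2, item 1423), regime (A)
# `stub_coherentTypeIExclusion`: reduction to `¬ TypeISingularityExists`

Work file of the stub worker for stub A of `Cruxes/CoherentScaleExclusion/Lines/birth.lean`.
-/

noncomputable section

namespace Summit.NavierStokesRegularity.NavierStokesRegularity.Theorems

set_option linter.dupNamespace false

open MeasureTheory Filter Set Metric Function Topology TopologicalSpace
open scoped ENNReal NNReal
open Literature.Analysis.FluidPDE

/-! ### Tool 1: `sup_t = esssup_t` for the scaled energy of a continuous field -/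

/-- **For a field continuous on the open backward slab of a parabolic ball, CKN's scaled energy
`A` (genuine `sup_t`, `cknA`) is at most Albritton–Barker's `A` (`esssup_t`, `cknAEss`)**:
`t ↦ ∫_{B_r} |u(t)|²` is lower semicontinuous (Fatou), so each value is attained on a set of
times of positive measure. [folklore] -/
theorem cknA_le_cknAEss_of_continuousOn {u : ℝ → (EuclideanSpace ℝ (Fin 3)) → (EuclideanSpace ℝ (Fin 3))} {r : ℝ} {z : ℝ × (EuclideanSpace ℝ (Fin 3))}
    (hcont : ContinuousOn (uncurry u) (Ioo (z.1 - r ^ 2) z.1 ×ˢ univ)) :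
    cknA r z u ≤ cknAEss r z u := by
  unfold cknA cknAEss
  set I : Set ℝ := Ioo (z.1 - r ^ 2) z.1 with hI
  set Gf : ℝ → ℝ≥0∞ := fun s => ∫⁻ x in ball z.2 r, ‖u s x‖ₑ ^ 2 with hGf
  have hconst : (fun s => (ENNReal.ofReal r)⁻¹ * ∫⁻ x in ball z.2 r, ‖u s x‖ₑ ^ 2) =
      fun s => (ENNReal.ofReal r)⁻¹ * Gf s := rfl
  rw [hconst, ENNReal.essSup_const_mul]
  refine iSup₂_le fun t ht => ?_
  set μ : Measure ℝ := volume.restrict I with hμ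
  suffices key : Gf t ≤ essSup Gf μ from mul_le_mul' le_rfl key
  by_contra hlt
  push Not at hlt
  have htI : t ∈ I := ht
  -- Fatou along `𝓝 t` inside the open interval `I` (a subtype, to keep junk slices out)
  have hmeas : ∀ i : I,
      AEMeasurable (fun x => ‖u i.1 x‖ₑ ^ 2) (volume.restrict (ball z.2 r)) := by
    intro i
    have hc : Continuous (u i.1) := by
      have h1 : Continuous fun x : (EuclideanSpace ℝ (Fin 3)) => uncurry u (i.1, x) :=
        hcont.comp_continuous (continuous_const.prodMk continuous_id)
          fun x => ⟨i.2, mem_univ _⟩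
      exact h1
    exact (hc.measurable.enorm.pow_const 2).aemeasurable
  have hFatou := lintegral_liminf_le' (μ := volume.restrict (ball z.2 r))
    (u := 𝓝 (⟨t, htI⟩ : I)) hmeas
  have hpt : ∀ x,
      liminf (fun i : I => ‖u i.1 x‖ₑ ^ 2) (𝓝 ⟨t, htI⟩) = ‖u t x‖ₑ ^ 2 := by
    intro x
    refine Tendsto.liminf_eq ?_
    have hca : ContinuousAt (uncurry u) (t, x) :=
      hcont.continuousAt ((isOpen_Ioo.prod isOpen_univ).mem_nhds ⟨ht, mem_univ _⟩)
    have h1 : Tendsto (fun s : ℝ => uncurry u (s, x)) (𝓝 t) (𝓝 (uncurry u (t, x))) :=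
      hca.tendsto.comp ((continuous_id.prodMk continuous_const).tendsto t)
    have h2 : Tendsto (fun i : I => u i.1 x) (𝓝 ⟨t, htI⟩) (𝓝 (u t x)) :=
      h1.comp (continuous_subtype_val.tendsto _)
    exact ENNReal.Tendsto.pow h2.enorm
  rw [lintegral_congr fun x => hpt x] at hFatou
  have hev : ∀ᶠ i : I in 𝓝 ⟨t, htI⟩, essSup Gf μ < Gf i.1 :=
    eventually_lt_of_lt_liminf (hlt.trans_le hFatou)
  rw [eventually_nhds_subtype_iff I ⟨t, htI⟩ (fun s => essSup Gf μ < Gf s),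
    isOpen_Ioo.nhdsWithin_eq htI, Metric.eventually_nhds_iff] at hev
  obtain ⟨ε, hε, hball⟩ := hev
  -- the set `ball t ε ∩ I` has positive measure but lies in the null set `{essSup < Gf}`
  have hpos : 0 < volume (ball t ε ∩ I) :=
    (isOpen_ball.inter isOpen_Ioo).measure_pos volume ⟨t, mem_ball_self hε, htI⟩
  have hnull : μ {s | essSup Gf μ < Gf s} = 0 := meas_essSup_lt
  have hsub : ball t ε ∩ I ⊆ {s | essSup Gf μ < Gf s} ∩ I :=
    fun s hs => ⟨hball hs.1, hs.2⟩
  rw [hμ, Measure.restrict_apply' measurableSet_Ioo] at hnull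
  exact hpos.ne' (measure_mono_null hsub hnull)

/-- `cknA` only sees the slices of the field on the time interval of the ball: slice-wise a.e.
equality there gives equal `cknA`. [folklore] -/
theorem cknA_congr_slice_ae {u v : ℝ → (EuclideanSpace ℝ (Fin 3)) → (EuclideanSpace ℝ (Fin 3))} {r : ℝ} {z : ℝ × (EuclideanSpace ℝ (Fin 3))}
    (h : ∀ t ∈ Ioo (z.1 - r ^ 2) z.1, u t =ᵐ[volume] v t) : cknA r z u = cknA r z v := by
  unfold cknA
  refine iSup_congr fun t => iSup_congr fun ht => ?_
  congr 1
  refine lintegral_congr_ae (ae_restrict_of_ae ((h t ht).mono fun x hx => ?_))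
  show ‖u t x‖ₑ ^ 2 = ‖v t x‖ₑ ^ 2
  rw [hx]


/-! ### Tool 2: a load ceiling at a non-bounded final-time point is a centred Type-I singularity
of the Leray continuation -/

/-- **A load ceiling at a final-time point where the solution is unbounded produces a centred
Type-I singular point** (`IsTypeISingularPoint`, at that very point, of a continuation of the
solution; in particular a witness of the registered OPEN statement `TypeISingularityExists`).
Let `(u, p)` be classical on `ℝ³ × [0, T)` (`ν = 1`), Leray–Hopf on `[0, T]` from the rapidly
decaying datum `u 0`, with `cknC r (T, x₀) u ≤ M₁` for `0 < r < r₁`, and suppose `u` is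
bounded on NO backward cylinder `(T − ρ², T) × B_ρ(x₀)`. Bridge past the final time: Leray's
global weak solution `v` from `u 0` with its Riesz pressure `q` is suitable on `(0, ∞) × ℝ³`
(`exists_isGlobalLerayHopf_and_isLocalEnergySolutionOn`, CKN 1982 Appendix), and coincides with
`u` a.e. on every slice `0 < t < T` (weak–strong uniqueness in `L^∞_t L^∞_x`,
`weak_strong_uniqueness_holds`, the strong class supplied by Tao 2013 Cor. 11.1 on closed
sub-slabs, `tao2011_hasBoundedSobolevNormsOn.memLqLp_top`); so on the open slab
`Q = (0, T+1) × ℝ³ ∋ (T, x₀)` the pair `(v, q)` is a suitable weak solution whose backward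
cylinders at `(T, x₀)` see only `u`: `(T, x₀)` is a singular point of `v` (continuity of `u`,
`enorm_le_eLpNorm_top_restrict_of_continuousOn`), `C(r; v) = C(r; u) ≤ M₁`, hence
`A + C + D + E` is bounded at the cylinders centred at `(T, x₀)` by Seregin's
"`sup C < ∞ ⇒ sup (A + D + E) < ∞`" (`Seregin2020.scaledEnergies_bounded_of_cknC_le`, with
`sup_t = esssup_t` for the continuous `u`, `cknA_le_cknAEss_of_continuousOn`).
[cite: SereginSverak2009, §1 (Type I = some scale-invariant quantity bounded at the point)]
[cite: Seregin2020, Def. 1.7 and the remark following it] -/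
theorem isTypeISingularPoint_of_loadCeiling_of_not_bdd {T : ℝ} (hT : 0 < T)
    {u : ℝ → (EuclideanSpace ℝ (Fin 3)) → (EuclideanSpace ℝ (Fin 3))} {p : ℝ → (EuclideanSpace ℝ (Fin 3)) → ℝ}
    (hcl : IsClassicalNSSolutionOn (Ico 0 T) 1 0 u p) (hLH : IsLerayHopfOn T 1 0 (u 0) u)
    (hdec : HasRapidSpatialDecay (u 0)) {x₀ : (EuclideanSpace ℝ (Fin 3))}
    (hceil : ∃ M₁ r₁ : ℝ, 0 < r₁ ∧ ∀ r ∈ Ioo 0 r₁,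
      cknC r ((T, x₀) : ℝ × (EuclideanSpace ℝ (Fin 3))) u ≤ ENNReal.ofReal M₁)
    (hbdd : ¬ ∃ ρ : ℝ, 0 < ρ ∧ ∃ M : ℝ,
      ∀ t ∈ Ioo (T - ρ ^ 2) T, ∀ x ∈ ball x₀ ρ, ‖u t x‖ ≤ M) :
    ∃ (Q : Opens (ℝ × (EuclideanSpace ℝ (Fin 3)))) (v : ℝ → (EuclideanSpace ℝ (Fin 3)) → (EuclideanSpace ℝ (Fin 3))) (q : ℝ → (EuclideanSpace ℝ (Fin 3)) → ℝ),
      IsTypeISingularPoint Q v q ((T, x₀) : ℝ × (EuclideanSpace ℝ (Fin 3))) := by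
  -- ### the Leray continuation: a global suitable Leray–Hopf solution from `u 0`
  have hu0 : MemLp (u 0) 2 volume := hLH.memLp 0 ⟨le_rfl, hT.le⟩
  have hdiv : IsWeaklyDivFree (u 0) := hLH.isWeaklyDivFree_datum hT
  obtain ⟨v, q, hGL, -, hvmeas, -, hq32, -, hLE⟩ :=
    exists_isGlobalLerayHopf_and_isLocalEnergySolutionOn (zero_lt_one : (0 : ℝ) < 1) hu0 hdiv
  -- ### weak–strong uniqueness on `[0, T']`, `T' < T`: `v(t) = u(t)` a.e. for `0 < t < T`
  have hslice : ∀ t ∈ Ioo 0 T, v t =ᵐ[volume] u t := by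
    intro t ht
    have hT' : (t + T) / 2 ∈ Ioo 0 T := ⟨by linarith [ht.1], by linarith [ht.2]⟩
    have hS : MemLqLp ⊤ ⊤ u (Ioo 0 ((t + T) / 2)) :=
      tao2011_hasBoundedSobolevNormsOn.memLqLp_top tao2011_hasBoundedSobolevNormsOn_holds
        linfty_bound_of_hasBoundedSobolevNormsOn_holds 1 T zero_lt_one hT u p hcl hLH hdec _ hT'
    have hu' : IsLerayHopfOn ((t + T) / 2) 1 0 (u 0) u := hLH.of_le hT'.2.le
    have hv' : IsLerayHopfOn ((t + T) / 2) 1 0 (u 0) v := hGL _ hT'.1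
    have h3 : (3 : ℝ≥0∞) < ⊤ := ENNReal.ofNat_lt_top
    have hqr : 2 / (⊤ : ℝ≥0∞) + 3 / (⊤ : ℝ≥0∞) ≤ 1 := by simp
    exact weak_strong_uniqueness_holds zero_lt_one hT'.1 hu' h3 hqr hS hv' t
      ⟨ht.1, by linarith [ht.2]⟩
  -- ### space–time a.e. equality on the strip `(0, T) × ℝ³`
  have hcont : ContinuousOn (uncurry u) (Ioo 0 T ×ˢ (univ : Set (EuclideanSpace ℝ (Fin 3)))) :=
    hcl.smooth_velocity.continuousOn.mono (Set.prod_mono Ioo_subset_Ico_self Subset.rfl)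
  have humeas : AEStronglyMeasurable (uncurry u) (volume.restrict (Ioo 0 T ×ˢ (univ : Set (EuclideanSpace ℝ (Fin 3))))) :=
    hcont.aestronglyMeasurable (measurableSet_Ioo.prod MeasurableSet.univ)
  have hvmeas' : AEStronglyMeasurable (uncurry v)
      (volume.restrict (Ioo 0 T ×ˢ (univ : Set (EuclideanSpace ℝ (Fin 3))))) := by
    have e : ((volume : Measure ℝ).restrict (Ioi 0)).prod (volume : Measure (EuclideanSpace ℝ (Fin 3))) =
        volume.restrict (Ioi (0 : ℝ) ×ˢ (univ : Set (EuclideanSpace ℝ (Fin 3)))) := by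
      rw [Measure.volume_eq_prod, ← Measure.restrict_univ (μ := (volume : Measure (EuclideanSpace ℝ (Fin 3)))),
        Measure.prod_restrict, Measure.restrict_univ]
    rw [e] at hvmeas
    exact hvmeas.mono_measure
      (Measure.restrict_mono (Set.prod_mono Ioo_subset_Ioi_self Subset.rfl) le_rfl)
  have hae : uncurry v =ᵐ[volume.restrict (Ioo 0 T ×ˢ (univ : Set (EuclideanSpace ℝ (Fin 3))))] uncurry u :=
    ae_restrict_prod_of_forall_ae_eq hslice hvmeas' humeas
  -- ### on the open slab `Q = (0, T+1) × ℝ³ ∋ (T, x₀)` the pair `(v, q)` is suitable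
  have hsw : IsSuitableWeakSolutionOn (slab (EuclideanSpace ℝ (Fin 3)) (Ioo 0 (T + 1)) isOpen_Ioo) 1 0 v q :=
    (hLE (T + 1) (by linarith)).suitable
  obtain ⟨G, hGw, -, -⟩ := hsw.localEnergy
  have hzQ : ((T, x₀) : ℝ × (EuclideanSpace ℝ (Fin 3))) ∈ slab (EuclideanSpace ℝ (Fin 3)) (Ioo 0 (T + 1)) isOpen_Ioo :=
    mem_slab.2 ⟨hT, by linarith⟩
  -- backward cylinders of radius `r`, `r² < T`, lie in the strip `(0, T) × ℝ³`
  have hcylT : ∀ {r : ℝ}, r ^ 2 < T →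
      parabolicCylinder r ((T, x₀) : ℝ × (EuclideanSpace ℝ (Fin 3))) ⊆ Ioo 0 T ×ˢ (univ : Set (EuclideanSpace ℝ (Fin 3))) := by
    intro r hrT w hw
    rw [mem_parabolicCylinder] at hw
    have hw1 : T - r ^ 2 < w.1 := hw.1.1
    have hw2 : w.1 < T := hw.1.2
    exact ⟨⟨by linarith, hw2⟩, mem_univ _⟩
  have hsqrt : (Real.sqrt T / 2) ^ 2 = T / 4 := by
    rw [div_pow, Real.sq_sqrt hT.le]; norm_num
  -- ### `(T, x₀)` is a singular point of `v`: its backward cylinders see the unbounded `u`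
  push Not at hbdd
  have hsing : ¬ IsRegularPoint v ((T, x₀) : ℝ × (EuclideanSpace ℝ (Fin 3))) := by
    rintro ⟨r, hr, hfin⟩
    set ρ : ℝ := min r (Real.sqrt T / 2) with hρ
    have hρ0 : 0 < ρ := lt_min hr (div_pos (Real.sqrt_pos.2 hT) two_pos)
    have hρr : ρ ≤ r := min_le_left _ _
    have hρT : ρ ^ 2 < T := by
      have h1 : ρ ^ 2 ≤ (Real.sqrt T / 2) ^ 2 := pow_le_pow_left₀ hρ0.le (min_le_right _ _) 2
      rw [hsqrt] at h1
      linarith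
    set S : ℝ≥0∞ := eLpNorm (uncurry v) ⊤
      (volume.restrict (parabolicCylinderCentered r ((T, x₀) : ℝ × (EuclideanSpace ℝ (Fin 3))))) with hS
    obtain ⟨t, ht, x, hx, hM⟩ := hbdd ρ hρ0 S.toReal
    have hUT := hcylT hρT
    have hUcen : parabolicCylinder ρ ((T, x₀) : ℝ × (EuclideanSpace ℝ (Fin 3))) ⊆
        parabolicCylinderCentered r ((T, x₀) : ℝ × (EuclideanSpace ℝ (Fin 3))) :=
      (parabolicCylinder_subset_centered ρ _).trans (parabolicCylinderCentered_mono hρ0.le hρr _)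
    have htxU : (t, x) ∈ parabolicCylinder ρ ((T, x₀) : ℝ × (EuclideanSpace ℝ (Fin 3))) := by
      rw [mem_parabolicCylinder]
      exact ⟨ht, mem_ball.1 hx⟩
    have h1 : ‖uncurry u (t, x)‖ₑ ≤
        eLpNorm (uncurry u) ⊤ (volume.restrict (parabolicCylinder ρ ((T, x₀) : ℝ × (EuclideanSpace ℝ (Fin 3))))) :=
      enorm_le_eLpNorm_top_restrict_of_continuousOn (μ := (volume : Measure (ℝ × (EuclideanSpace ℝ (Fin 3)))))
        (isOpen_parabolicCylinder ρ _) (hcont.mono hUT) htxU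
    have h2 :
        eLpNorm (uncurry u) ⊤ (volume.restrict (parabolicCylinder ρ ((T, x₀) : ℝ × (EuclideanSpace ℝ (Fin 3))))) =
          eLpNorm (uncurry v) ⊤ (volume.restrict (parabolicCylinder ρ ((T, x₀) : ℝ × (EuclideanSpace ℝ (Fin 3))))) :=
      eLpNorm_congr_ae (Filter.EventuallyEq.symm (ae_restrict_of_ae_restrict_of_subset hUT hae))
    have h3 :
        eLpNorm (uncurry v) ⊤ (volume.restrict (parabolicCylinder ρ ((T, x₀) : ℝ × (EuclideanSpace ℝ (Fin 3))))) ≤ S :=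
      eLpNorm_mono_measure _ (Measure.restrict_mono hUcen le_rfl)
    have h4 : ENNReal.ofReal ‖u t x‖ ≤ S := by
      rw [ofReal_norm]
      exact h1.trans (h2.le.trans h3)
    have h5 : ‖u t x‖ ≤ S.toReal := (ENNReal.ofReal_le_iff_le_toReal hfin.ne).1 h4
    linarith
  -- ### the centred Type-I bound: `C(v) = C(u) ≤ M₁`, then Seregin's `C ⇒ A + D + E`
  obtain ⟨M₁, r₁, hr₁, hC⟩ := hceil
  set r₂ : ℝ := min (r₁ / 2) (Real.sqrt T / 2) with hr₂
  have hr₂0 : 0 < r₂ := lt_min (half_pos hr₁) (div_pos (Real.sqrt_pos.2 hT) two_pos)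
  have hr₂r₁ : r₂ < r₁ := lt_of_le_of_lt (min_le_left _ _) (half_lt_self hr₁)
  have hr₂T : r₂ ^ 2 < T := by
    have h1 : r₂ ^ 2 ≤ (Real.sqrt T / 2) ^ 2 :=
      pow_le_pow_left₀ hr₂0.le (min_le_right _ _) 2
    rw [hsqrt] at h1
    linarith
  have hrT : ∀ {r : ℝ}, 0 < r → r ≤ r₂ → r ^ 2 < T := fun hr hrr₂ =>
    lt_of_le_of_lt (pow_le_pow_left₀ hr.le hrr₂ 2) hr₂T
  have hcylQ : parabolicCylinder r₂ ((T, x₀) : ℝ × (EuclideanSpace ℝ (Fin 3))) ⊆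
      ((slab (EuclideanSpace ℝ (Fin 3)) (Ioo 0 (T + 1)) isOpen_Ioo : Opens (ℝ × (EuclideanSpace ℝ (Fin 3)))) : Set (ℝ × (EuclideanSpace ℝ (Fin 3)))) := by
    intro w hw
    have hw' := hcylT hr₂T hw
    show w ∈ Ioo 0 (T + 1) ×ˢ (univ : Set (EuclideanSpace ℝ (Fin 3)))
    exact ⟨⟨hw'.1.1, by linarith [hw'.1.2]⟩, mem_univ _⟩
  have hD : cknD r₂ ((T, x₀) : ℝ × (EuclideanSpace ℝ (Fin 3))) q ≠ ∞ := by
    unfold cknD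
    refine ENNReal.mul_ne_top ?_
      (lt_of_le_of_lt (lintegral_mono_set (hcylT hr₂T)) (hq32 T hT)).ne
    exact ENNReal.inv_ne_top.2 (pow_ne_zero _ (ENNReal.ofReal_pos.2 hr₂0).ne')
  have hCv : ∀ r ∈ Ioc 0 r₂,
      cknC r ((T, x₀) : ℝ × (EuclideanSpace ℝ (Fin 3))) v ≤ ((M₁.toNNReal : ℝ≥0) : ℝ≥0∞) := by
    intro r hr
    have hae' : ∀ᵐ w ∂(volume.restrict (parabolicCylinder r ((T, x₀) : ℝ × (EuclideanSpace ℝ (Fin 3))))),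
        uncurry v w = uncurry u w :=
      ae_restrict_of_ae_restrict_of_subset (hcylT (hrT hr.1 hr.2)) hae
    rw [cknC_congr_ae hae']
    exact hC r ⟨hr.1, lt_of_le_of_lt hr.2 hr₂r₁⟩
  obtain ⟨K, hK⟩ := Seregin2020.scaledEnergies_bounded_of_cknC_le hsw hGw hr₂0 hcylQ hD hCv
  -- ### the centred Type-I singular point
  refine ⟨slab (EuclideanSpace ℝ (Fin 3)) (Ioo 0 (T + 1)) isOpen_Ioo, v, q, hsw, ⟨hzQ, hsing⟩, G, hGw, r₂ / 2,
    half_pos hr₂0,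
    (parabolicCylinder_mono (half_pos hr₂0).le (half_le_self hr₂0.le) _).trans hcylQ, ?_⟩
  have hKtop : ((K : ℝ≥0∞) + K + K + K) < ⊤ :=
    ENNReal.add_lt_top.2 ⟨ENNReal.add_lt_top.2 ⟨ENNReal.add_lt_top.2
      ⟨ENNReal.coe_lt_top, ENNReal.coe_lt_top⟩, ENNReal.coe_lt_top⟩, ENNReal.coe_lt_top⟩
  refine lt_of_le_of_lt (iSup₂_le fun r hr => ?_) hKtop
  have hr2 : r ≤ r₂ := hr.2.le.trans (half_le_self hr₂0.le)
  have hK' := hK r ⟨hr.1, hr.2.le⟩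
  -- `A`: the slices of `v` below `T` are those of `u`, and `sup_t = esssup_t` for `u`
  have hA : cknA r ((T, x₀) : ℝ × (EuclideanSpace ℝ (Fin 3))) v ≤ K := by
    have hsl : ∀ t ∈ Ioo (((T, x₀) : ℝ × (EuclideanSpace ℝ (Fin 3))).1 - r ^ 2) ((T, x₀) : ℝ × (EuclideanSpace ℝ (Fin 3))).1,
        v t =ᵐ[volume] u t := by
      intro t ht
      have ht1 : T - r ^ 2 < t := ht.1
      have ht2 : t < T := ht.2
      exact hslice t ⟨by linarith [hrT hr.1 hr2], ht2⟩
    have hae' : ∀ᵐ w ∂(volume.restrict (parabolicCylinder r ((T, x₀) : ℝ × (EuclideanSpace ℝ (Fin 3))))),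
        uncurry v w = uncurry u w :=
      ae_restrict_of_ae_restrict_of_subset (hcylT (hrT hr.1 hr2)) hae
    have hcontr : ContinuousOn (uncurry u)
        (Ioo (((T, x₀) : ℝ × (EuclideanSpace ℝ (Fin 3))).1 - r ^ 2) ((T, x₀) : ℝ × (EuclideanSpace ℝ (Fin 3))).1 ×ˢ
          (univ : Set (EuclideanSpace ℝ (Fin 3)))) := by
      refine hcont.mono (Set.prod_mono ?_ Subset.rfl)
      show Ioo (T - r ^ 2) T ⊆ Ioo 0 T
      exact Ioo_subset_Ioo (by linarith [hrT hr.1 hr2]) le_rfl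
    calc cknA r ((T, x₀) : ℝ × (EuclideanSpace ℝ (Fin 3))) v
        = cknA r ((T, x₀) : ℝ × (EuclideanSpace ℝ (Fin 3))) u := cknA_congr_slice_ae hsl
      _ ≤ cknAEss r ((T, x₀) : ℝ × (EuclideanSpace ℝ (Fin 3))) u := cknA_le_cknAEss_of_continuousOn hcontr
      _ = cknAEss r ((T, x₀) : ℝ × (EuclideanSpace ℝ (Fin 3))) v := (cknAEss_congr_ae hae').symm
      _ ≤ cknAEss r ((T, x₀) : ℝ × (EuclideanSpace ℝ (Fin 3))) v + cknE r ((T, x₀) : ℝ × (EuclideanSpace ℝ (Fin 3))) G +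
            cknC r ((T, x₀) : ℝ × (EuclideanSpace ℝ (Fin 3))) v + cknD r ((T, x₀) : ℝ × (EuclideanSpace ℝ (Fin 3))) q :=
          le_add_right (le_add_right (le_add_right le_rfl))
      _ ≤ K := hK'
  have hE : cknE r ((T, x₀) : ℝ × (EuclideanSpace ℝ (Fin 3))) G ≤ K :=
    (le_add_right (le_add_right (le_add_left le_rfl))).trans hK'
  have hCC : cknC r ((T, x₀) : ℝ × (EuclideanSpace ℝ (Fin 3))) v ≤ K := (le_add_right (le_add_left le_rfl)).trans hK'
  have hDD : cknD r ((T, x₀) : ℝ × (EuclideanSpace ℝ (Fin 3))) q ≤ K := (le_add_left le_rfl).trans hK'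
  unfold cknSum
  exact add_le_add (add_le_add (add_le_add hA hCC) hDD) hE

/-! ### The conditional reduction of stub A -/

/-- **Regime (A) of the crux `CoherentScaleExclusion` (the registered stub
`stub_coherentTypeIExclusion`, verbatim) follows from `¬ TypeISingularityExists`** — the
registered OPEN statement "no suitable weak solution of the unforced equations has a (centred)
Type-I singular point" (Seregin–Šverák 2009 §1 / Albritton–Barker 2019 Thm 1.1 first bullet,
centred form; expected TRUE under the KNSS Liouville conjecture, but not derived from it in the
centred form). With `M := 0` and WITHOUT using the coherence (`¬ MIX`) or the load hypothesis: a
Type-I ceiling `cknC r (T, x₀) u ≤ M₁` (`0 < r < r₁`) at a point where `u` were unbounded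
would make `(T, x₀)` a centred Type-I singular point of the Leray continuation of `u`
(`isTypeISingularPoint_of_loadCeiling_of_not_bdd`). [folklore] -/
theorem coherentTypeIRegime_of_not_typeISingularityExists :
    ¬ Literature.Analysis.FluidPDE.TypeISingularityExists → ∀ δ : ℝ, 0 < δ → ∃ M : ℝ, ∀ T : ℝ, 0 < T → ∀ (u : ℝ → EuclideanSpace ℝ (Fin 3) → EuclideanSpace ℝ (Fin 3)) (p : ℝ → EuclideanSpace ℝ (Fin 3) → ℝ), Literature.Analysis.FluidPDE.IsClassicalNSSolutionOn (Set.Ico 0 T) 1 0 u p → Literature.Analysis.FluidPDE.IsLerayHopfOn T 1 0 (u 0) u → Literature.Analysis.FluidPDE.HasRapidSpatialDecay (u 0) → ∀ x₀ : EuclideanSpace ℝ (Fin 3), (∃ M₁ r₁ : ℝ, 0 < r₁ ∧ ∀ r ∈ Set.Ioo 0 r₁, Literature.Analysis.FluidPDE.cknC r ((T, x₀) : ℝ × EuclideanSpace ℝ (Fin 3)) u ≤ ENNReal.ofReal M₁) → (∀ r₀ : ℝ, 0 < r₀ → ∃ r ∈ Set.Ioo 0 r₀, ENNReal.ofReal M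 ≤ Literature.Analysis.FluidPDE.cknC r ((T, x₀) : ℝ × EuclideanSpace ℝ (Fin 3)) u ∧ ¬ (∀ θ : ℝ → EuclideanSpace ℝ (Fin 3) → ℝ, Literature.Analysis.FluidPDE.IsSmoothSpaceTimeOn (Set.Icc (T - r ^ 2) (T - r ^ 2 / 2)) θ → Literature.Analysis.FluidPDE.HasUniformRapidDecayOn (Set.Icc (T - r ^ 2) (T - r ^ 2 / 2)) θ → (∀ t ∈ (Set.Icc (T - r ^ 2) (T - r ^ 2 / 2)), ∀ x : EuclideanSpace ℝ (Fin 3), Literature.Analysis.FluidPDE.timeDerivWithin (Set.Icc (T - r ^ 2) (T - r ^ 2 / 2)) θ t x + inner ℝ (u t x) (gradient (θ t) x) = Laplacian.laplacian (θ t) x) → Function.support (θ (T - r ^ 2)) ⊆ Metric.ball x₀ r → ∫ x, (θ (T - r ^ 2 / 2) x) ^ 2 ≤ δ ^ 2 * ∫ x, (θ (T - r ^ 2) x) ^ 2)) → (∃ ρ : ℝ, 0 < ρ ∧ ∃ M : ℝ, ∀ t ∈ Set.Ioo (T - ρ ^ 2) T, ∀ x ∈ Metric.ball x₀ ρ, ‖u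 t x‖ ≤ M) := by
  intro hX δ _hδ
  refine ⟨0, fun T hT u p hcl hLH hdec x₀ hceil _hrec => ?_⟩
  by_contra hbdd
  obtain ⟨Q, v, q, h⟩ :=
    isTypeISingularPoint_of_loadCeiling_of_not_bdd hT hcl hLH hdec hceil hbdd
  exact hX ⟨Q, v, q, _, h⟩

end Summit.NavierStokesRegularity.NavierStokesRegularity.Theorems

end
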